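import Literature.LinearAlgebra.UnipotentLogarithm
import Mathlib.Data.Finset.NoncommProd
import HarnessLib

/-!
# Commuting unipotent monodromies: `log ∏ γ_j = ∑ N_j`, `exp (∑ z_j N_j) = ∏ exp (z_j N_j)`, and `N = T − 1` when `N² = 0`

Family `hodge`, layer `Literature/LinearAlgebra`, a leaf on `UnipotentLogarithm.lean` (`unipotentLog`,
`unipotentLog_mul_of_commute`, `commute_unipotentLog_iff`).  Theorems only; no definition, no instance,
no named fact.  The algebra of several commuting (local) monodromy transformations `γ_1, …, γ_r` of a
variation of Hodge structure over `(Δ*)^r`: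

* E. Cattani, F. El Zein, P. Griffiths, Lê D. T. (eds.), *Hodge Theory* (PMN-49), §7.5 (held
  `book:cattani2014-hodge-theory-princeton-mathematical-notes-49` p0301–p0303): "Clearly the monodromy
  transformations `γ_j`, `j = 1, …, r`, commute." (before Thm. 7.5.1); (7.5.2) "`γ_j = e^{N_j}`";
  (7.5.3) "`Ψ(z_1, …, z_r) := exp(-∑_j z_j N_j) · Φ̃(z_1, …, z_r)`"; (7.5.6)
  "`exp(∑_j (log t_j / 2πi) N_j) · v^♭(t, w)`".
* E. Cattani, Ch. V §1 of *Topics in Transcendental Algebraic Geometry* (Ann. of Math. Studies 106;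
  held `book:griffiths1984-topics-transcendental-algebraic-geometry` p0046): "By the Monodromy Theorem,
  `N² = 0` and therefore in this case `N = (γ − I)`." and (p0052, curve degenerations) "We have
  `N_j = log γ_j = (γ_j − I)`".

Contents (any `ℚ`-algebra `B`):
* §1 **`commute_iff_commute_unipotentLog`** — unipotent `a`, `b` commute iff their logarithms do
  (`γ_i γ_j = γ_j γ_i ↔ N_i N_j = N_j N_i`); `commute_iff_commute_isNilpotentExp` (nilpotent side).
* §2 **`unipotentLog_noncommProd`** — `log (∏_j u_j) = ∑_j log u_j` for a pairwise commuting finite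
  family of unipotents (`Finset.noncommProd`); `isNilpotent_noncommProd_sub_one`;
  **`isNilpotentExp_sum`** — `exp (∑_j a_j) = ∏_j exp a_j` for pairwise commuting nilpotents; with
  scalars `isNilpotentExp_sum_smul` — `exp (∑_j z_j • N_j) = ∏_j exp (z_j • N_j)` ((7.5.3)/(7.5.6)).
* §3 **`unipotentLog_eq_sub_one_of_sq_eq_zero`** — if `(b − 1)² = 0` then `log b = b − 1`
  ("`N² = 0` and therefore `N = γ − I`"); `sq_unipotentLog_eq_zero_iff` (`N² = 0 ↔ (T − 1)² = 0`);
  `isNilpotentExp_eq_one_add_of_sq_eq_zero` (`exp N = 1 + N` when `N² = 0`).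

## References

* E. Cattani et al. (eds.), *Hodge Theory*, Princeton Math. Notes 49 (2014), §7.5, Thm. 7.5.1,
  (7.5.2), (7.5.3), (7.5.6). [CattaniElZeinGriffithsLe2014]
* P. Griffiths (ed.), *Topics in Transcendental Algebraic Geometry*, Ann. of Math. Studies 106 (1984),
  Ch. V §1 (E. Cattani). [Griffiths1984Topics]
* N. Bourbaki, *Lie Groups and Lie Algebras, Chapters 1–3*, Ch. II §6 no. 1, Remarks (1), (4).
  [Bourbaki1989LieGroups13]
-/

open Finset

namespace Literature.LinearAlgebra

variable {B : Type*} [Ring B] [Algebra ℚ B]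

/-! ### §1 Commuting monodromies have commuting logarithms -/

/-- **`γ_i γ_j = γ_j γ_i ↔ N_i N_j = N_j N_i`**: unipotent elements commute iff their logarithms commute
("the monodromy transformations `γ_j` commute", `γ_j = e^{N_j}`).
[cite: CattaniElZeinGriffithsLe2014, §7.5 (before Thm. 7.5.1) and (7.5.2)]
[cite: Bourbaki1989LieGroups13, Ch. II §6 no. 1, Remark (4)] -/
theorem commute_iff_commute_unipotentLog {a b : B} (ha : IsNilpotent (a - 1)) (hb : IsNilpotent (b - 1)) :
    Commute a b ↔ Commute (unipotentLog a) (unipotentLog b) := by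
  refine ⟨fun h => Commute.unipotentLog_unipotentLog h, fun h => ?_⟩
  have h1 : Commute (unipotentLog a) b := (commute_unipotentLog_iff hb).1 h
  exact ((commute_unipotentLog_iff ha).1 h1.symm).symm

/-- Nilpotent elements commute iff their exponentials commute.
[cite: CattaniElZeinGriffithsLe2014, §7.5 (before Thm. 7.5.1) and (7.5.2)]
[cite: Bourbaki1989LieGroups13, Ch. II §6 no. 1, Remark (4)] -/
theorem commute_iff_commute_isNilpotentExp {a b : B} (ha : IsNilpotent a) (hb : IsNilpotent b) :
    Commute a b ↔ Commute (IsNilpotent.exp a) (IsNilpotent.exp b) := by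
  rw [commute_iff_commute_unipotentLog (IsNilpotent.isNilpotent_exp_sub_one ha)
    (IsNilpotent.isNilpotent_exp_sub_one hb), unipotentLog_exp ha, unipotentLog_exp hb]

/-! ### §2 Finite commuting families -/

omit [Algebra ℚ B] in
/-- A product of pairwise commuting unipotents is unipotent. [cite: Bourbaki1989LieGroups13, Ch. II §6 no. 1, Remark (4)]
[cite: CattaniElZeinGriffithsLe2014, §7.5 and (7.5.2)] -/
theorem isNilpotent_noncommProd_sub_one {ι : Type*} (s : Finset ι) (u : ι → B)
    (comm : (s : Set ι).Pairwise (Function.onFun Commute u)) (hu : ∀ i ∈ s, IsNilpotent (u i - 1)) :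
    IsNilpotent (s.noncommProd u comm - 1) := by
  classical
  induction s using Finset.induction_on with
  | empty => simp
  | insert i s hi ih =>
    rw [noncommProd_insert_of_notMem _ _ _ _ hi]
    have comm' : (s : Set ι).Pairwise (Function.onFun Commute u) := comm.mono fun _ => mem_insert_of_mem
    exact isNilpotent_mul_sub_one_of_commute
      (noncommProd_commute _ _ _ _ fun j hj => comm (mem_insert_self i s) (mem_insert_of_mem hj)
        (by rintro rfl; exact hi hj))
      (hu i (mem_insert_self i s)) (ih comm' fun j hj => hu j (mem_insert_of_mem hj))

/-- **`log (∏_j u_j) = ∑_j log u_j`** for a finite family of pairwise commuting unipotent elements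
(Remark (1) `exp(x + y) = exp x · exp y` for commuting `x, y`, iterated, read through `log`).
[cite: Bourbaki1989LieGroups13, Ch. II §6 no. 1, Remarks (1), (4)] [cite: CattaniElZeinGriffithsLe2014, (7.5.2)–(7.5.3)] -/
theorem unipotentLog_noncommProd {ι : Type*} (s : Finset ι) (u : ι → B)
    (comm : (s : Set ι).Pairwise (Function.onFun Commute u)) (hu : ∀ i ∈ s, IsNilpotent (u i - 1)) :
    unipotentLog (s.noncommProd u comm) = ∑ i ∈ s, unipotentLog (u i) := by
  classical
  induction s using Finset.induction_on with
  | empty => simp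
  | insert i s hi ih =>
    have comm' : (s : Set ι).Pairwise (Function.onFun Commute u) := comm.mono fun _ => mem_insert_of_mem
    rw [noncommProd_insert_of_notMem _ _ _ _ hi, sum_insert hi,
      unipotentLog_mul_of_commute
        (noncommProd_commute _ _ _ _ fun j hj => comm (mem_insert_self i s) (mem_insert_of_mem hj)
          (by rintro rfl; exact hi hj))
        (hu i (mem_insert_self i s))
        (isNilpotent_noncommProd_sub_one s u comm' fun j hj => hu j (mem_insert_of_mem hj)),
      ih comm' fun j hj => hu j (mem_insert_of_mem hj)]

/-- **`exp (∑_j a_j) = ∏_j exp a_j`** for a finite family of pairwise commuting nilpotent elements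
(the product taken as `Finset.noncommProd`; the exponentials commute pairwise).
[cite: Bourbaki1989LieGroups13, Ch. II §6 no. 1, Remark (1)] [cite: CattaniElZeinGriffithsLe2014, (7.5.3)] -/
theorem isNilpotentExp_sum {ι : Type*} (s : Finset ι) (a : ι → B)
    (comm : (s : Set ι).Pairwise (Function.onFun Commute a)) (ha : ∀ i ∈ s, IsNilpotent (a i)) :
    IsNilpotent.exp (∑ i ∈ s, a i) =
      s.noncommProd (fun i => IsNilpotent.exp (a i))
        (fun _ hi _ hj hij => Commute.isNilpotentExp_left
          (Commute.isNilpotentExp_right (comm hi hj hij))) := by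
  classical
  induction s using Finset.induction_on with
  | empty => simp
  | insert i s hi ih =>
    have comm' : (s : Set ι).Pairwise (Function.onFun Commute a) := comm.mono fun _ => mem_insert_of_mem
    have hcomm : Commute (a i) (∑ j ∈ s, a j) :=
      Commute.sum_right _ _ _ fun j hj => comm (mem_insert_self i s) (mem_insert_of_mem hj)
        (by rintro rfl; exact hi hj)
    rw [sum_insert hi, noncommProd_insert_of_notMem _ _ _ _ hi,
      IsNilpotent.exp_add_of_commute hcomm (ha i (mem_insert_self i s))
        (Commute.isNilpotent_sum (fun j hj => ha j (mem_insert_of_mem hj))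
          fun j k hj hk => by
            by_cases hjk : j = k
            · subst hjk; exact Commute.refl _
            · exact comm (mem_insert_of_mem hj) (mem_insert_of_mem hk) hjk),
      ih comm' fun j hj => ha j (mem_insert_of_mem hj)]

/-- **`exp (∑_j z_j • N_j) = ∏_j exp (z_j • N_j)`** for pairwise commuting nilpotent `N_j` and scalars
`z_j` (the operator "`exp(-∑ z_j N_j)`" of the several-variables nilpotent orbit).
[cite: CattaniElZeinGriffithsLe2014, (7.5.3) and (7.5.6)] -/
theorem isNilpotentExp_sum_smul {ι : Type*} {K : Type*} [CommRing K] [Algebra K B]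
    (s : Finset ι) (N : ι → B) (z : ι → K)
    (comm : (s : Set ι).Pairwise (Function.onFun Commute N)) (hN : ∀ i ∈ s, IsNilpotent (N i)) :
    IsNilpotent.exp (∑ i ∈ s, z i • N i) =
      s.noncommProd (fun i => IsNilpotent.exp (z i • N i))
        (fun i hi j hj hij => Commute.isNilpotentExp_left (Commute.isNilpotentExp_right
          (((comm hi hj hij).smul_left (z i)).smul_right (z j)))) :=
  isNilpotentExp_sum s (fun i => z i • N i)
    (fun i hi j hj hij => ((comm hi hj hij).smul_left (z i)).smul_right (z j))
    fun i hi => (hN i hi).smul (z i)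

/-! ### §3 The case `N² = 0`: `N = T − 1` -/

omit [Algebra ℚ B] in
/-- `(b − 1)² = 0` written as a square. [folklore] -/
private theorem sub_one_sq_eq_zero_iff (b : B) : (b - 1) ^ 2 = 0 ↔ (b - 1) * (b - 1) = 0 := by
  rw [sq]

/-- **"`N² = 0` and therefore `N = (γ − I)`"**: if `(b − 1)² = 0` then `log b = b − 1` (the
logarithm series stops after its first term; weight-one and curve degenerations, type II
degenerations of K3 surfaces). [cite: Griffiths1984Topics, Ch. V §1 (p0046, p0052)] -/
theorem unipotentLog_eq_sub_one_of_sq_eq_zero {b : B} (hb : (b - 1) ^ 2 = 0) :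
    unipotentLog b = b - 1 := by
  rw [unipotentLog_eq_sum hb, sum_range_succ, sum_range_succ, sum_range_zero]
  norm_num

/-- `N² = 0 ↔ (T − 1)² = 0` for `N = log T` (index of nilpotency two).
[cite: Griffiths1984Topics, Ch. V §1 (p0046)] [cite: CattaniElZeinGriffithsLe2014, Thm. 7.5.1] -/
theorem sq_unipotentLog_eq_zero_iff {b : B} (hb : IsNilpotent (b - 1)) :
    unipotentLog b ^ 2 = 0 ↔ (b - 1) ^ 2 = 0 :=
  (sub_one_pow_eq_zero_iff_unipotentLog_pow_eq_zero hb 2).symm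

/-- `exp N = 1 + N` when `N² = 0` (so `T − 1 = N`). [cite: Griffiths1984Topics, Ch. V §1 (p0046, p0052)] -/
theorem isNilpotentExp_eq_one_add_of_sq_eq_zero {a : B} (ha : a ^ 2 = 0) :
    IsNilpotent.exp a = 1 + a := by
  rw [IsNilpotent.exp_eq_sum ha, sum_range_succ, sum_range_succ, sum_range_zero]
  norm_num

end Literature.LinearAlgebra
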